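/-
Copyright: the b2b-balaban cell (near-miss cell 7), T⁴-continuum fan-out, lineage t4-ne7b-p1 (node U5c COUNT member).
Released under the licence of the surrounding project.
-/
import Summits.QuantumFields.BalabanUV.T4Continuum.Support.PartnerMultiplicityFloor

/-!
# No room condition: the class-linear ∕ zone-crowding surcharge is absorbed by the INFRARED THRESHOLD

Summits-side support leaf of the T⁴-continuum cell (rung (B)+1 on a FINITE torus only; NOT infinite volume, NOT the
mass gap, NOT the Clay statement; NOT a proof of the spine estimate NE7b).  Lineage `t4-ne7b-p1` (generation 20),
node U5c, wall (GM), located item G-ne7bp1g18-2 (d) — the «(E2)-side ROOM» of the binder re-typings, REMOVED.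
[folklore] bookkeeping over the lineage's OWN typed carrier; nothing is quoted from print and nothing printed is asserted;
no `[cite:]` tag.

WHY.  `Support/PartnerMultiplicityG`∕`Z`∕`Floor` pay the surcharge `θ·Σ_{births}(d′+1)` (class-linear; `θ = zoneRate`
for the zone form, an astronomically large typed constant) by LOWERING the quadratic birth constant `a`, and therefore
display a ROOM CONDITION — `θ < C.a` (G∕Z), `θ < C.a·C.A₀²` (Floor) — read in the census as «an (E2)-side constant:
whether print's `a`, `A₀` leave that room is not decided».  But a birth's credit is `a·p₀(g_s)²·(d′+1)` with the
PROFILE `p₀(g_s) = A₀·(log g_s⁻²)^{p₀}`, and along a run the infrared profile is the smallest up to `1+β₀`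
(`T4PersistentHistoryCount.p0Profile_ir_le`, from the typed (2.7)): `p₀(g_s) ≥ p₀(g_K)∕(1+β₀) ≥ A₀·x_K^{p₀}∕(1+β₀)`,
`x_K = log g_K⁻²`.  The chain ALREADY carries a K-uniform threshold `x₀ ≤ x_K` on the infrared coupling (chosen after
the constants, before the run).  Enlarging it to `x₀ ≥ 2θ(1+β₀)²∕(a·A₀²)` (and `≥ 1`) makes the floor
`P = p₀(g_K)∕(1+β₀)` satisfy `θ∕P² ≤ a∕2`, so lowering `a` by `θ∕P²` (`credits_lowerA_add_le_floor`) costs at most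
half of `a` — for EVERY `θ ≥ 0`.  Hence NO ROOM CONDITION: the displayed binders are `0 < C.a`, `0 < C.A₀` (as in the
original `exists_irThreshold_relWeightBoundM`) and `0 ≤ θ`; the surcharge only moves the infrared threshold — print's
«for p₀ large and γ small enough» (CONTEXT, (1.88) p. 387), K-uniformly.

WHAT.  §1 `credit_lowerA_anti`∕`credits_lowerA_anti` (credits are antitone in the lowering), `floor_of_ir` (the floor
`p₀(g_K)∕(1+β₀) ≤ p₀(g_s)` for `s ≤ K`), `half_room_of_threshold` (the arithmetic `θ∕P² ≤ a∕2`).  §2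
**`exists_irThreshold_relWeightBoundG_threshold`**: `PartnerMultiplicityFloor.exists_irThreshold_relWeightBoundG_floor`
VERBATIM except the binder `θ < C.a·C.A₀²` is REPLACED by `0 < C.a` (proof: the landed `M`-chain at `lowerA C (a∕2)`,
threshold `max x₀' (max 1 (2θ(1+β₀)²∕(a·A₀²)))`).  §3 **`exists_irThreshold_relWeightBoundZ_threshold`**: the `hlabZ`
chain (`PartnerMultiplicityZ`) with the binder `zoneRate Kz p σ ε θ < …` REPLACED by `0 < C.a` — the zone-crowding
multiplicity needs NO room, only a larger infrared threshold.  Everything else VERBATIM.  NE7b discharge: no date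
((ID) G-ne7bp1g9-1, (E2)∕(R1) G-ne7bp1-1 untouched).

HONEST DEPENDENCY (cell): continuum YM on T⁴ ⇐ BetaPertH ∧ nine spine estimates (0/9 proved); BetaPertH ⇐ (D1) ∧ (D4)
∧ CAP+tail.  This file changes none of it.
-/

open Finset
open Literature.MathematicalPhysics.QuantumFieldTheory.Balaban1983to89
open T4PersistenceDictionary T4PersistentHistoryCount T4BankedInduction T4PrintedShapeBanking
open T4WeightBudget T4GlobalDenominator T4LiveClassFibration T4LiveStructureGas T4LiveGasToTerms T4RecordPriceSeam
open T4PartnerMultiplicity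
open Summit.QuantumFields.BalabanUV.T4Continuum.PlacementBatch
open Summit.QuantumFields.BalabanUV.T4Continuum.PlacementSkeleton
open Summit.QuantumFields.BalabanUV.T4Continuum.PartnerMultiplicityF
open Summit.QuantumFields.BalabanUV.T4Continuum.PartnerMultiplicityG
open Summit.QuantumFields.BalabanUV.T4Continuum.PartnerMultiplicityZ
open Summit.QuantumFields.BalabanUV.T4Continuum.PartnerMultiplicityFloor
open Summit.QuantumFields.BalabanUV.T4Continuum.Crowding

namespace Summit.QuantumFields.BalabanUV.T4Continuum.PartnerMultiplicityThreshold

noncomputable section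

/-! ## §1 Antitonicity of the credits in the lowering; the infrared floor; the half-room arithmetic -/

/-- a larger lowering gives a smaller credit (kind `0`: `(a − t)·p₀²·(d′+1) + 2p₀`; other kinds do not see `a`)
[folklore] -/
theorem credit_lowerA_anti (C : T4PrintedShapeBanking.Consts) (g : ℕ → ℝ) {t₁ t₂ : ℝ} (h : t₁ ≤ t₂) (e : PEv) :
    credit (lowerA C t₂) g e ≤ credit (lowerA C t₁) g e := by
  by_cases hk : e.kind = 0
  · rw [credit_of_kind_eq_zero _ _ hk, credit_of_kind_eq_zero _ _ hk, lowerA_a, lowerA_A₀, lowerA_p₀, lowerA_a,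
      lowerA_A₀, lowerA_p₀]
    have : 0 ≤ p0Profile C.A₀ C.p₀ (g e.step) ^ 2 * ((e.fat : ℝ) + 1) := by positivity
    nlinarith
  · rw [credit_lowerA_of_kind_ne C g _ hk, credit_lowerA_of_kind_ne C g _ hk]

/-- … summed over a genealogy [folklore] -/
theorem credits_lowerA_anti (C : T4PrintedShapeBanking.Consts) (g : ℕ → ℝ) {t₁ t₂ : ℝ} (h : t₁ ≤ t₂) (G : Gen PEv) :
    credits (credit (lowerA C t₂) g) G ≤ credits (credit (lowerA C t₁) g) G :=
  sum_le_sum fun e _ => credit_lowerA_anti C g h e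

/-- **THE INFRARED FLOOR**: along a run obeying the typed (2.7) (first member), `p₀(g_K)∕(1+β₀) ≤ p₀(g_s)` for every
`s ≤ K`. [folklore] -/
theorem floor_of_ir {g : ℕ → ℝ} {β' β₀ A₀ : ℝ} {p₀ K : ℕ} (h27 : B14.FlowIneq27 g β' β₀ p₀ K) (hβ : 0 ≤ β₀)
    (hA : 0 ≤ A₀) (hxK : 0 ≤ Real.log ((g K) ^ 2)⁻¹) {s : ℕ} (hs : s ≤ K) :
    p0Profile A₀ p₀ (g K) / (1 + β₀) ≤ p0Profile A₀ p₀ (g s) := by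
  rw [div_le_iff₀ (by linarith), mul_comm]
  exact p0Profile_ir_le h27 hβ hA hxK hs

/-- **THE HALF-ROOM ARITHMETIC**: if `x ≥ 1`, `x ≥ 2θ(1+β₀)²∕(a·A₀²)`, `p₀ ≥ 1`, `a, A₀ > 0`, `β₀ ≥ 0`, then with
`P = A₀·x^{p₀}∕(1+β₀)`: `0 < P` and `θ∕P² ≤ a∕2`. [folklore] -/
theorem half_room_of_threshold {a A₀ β₀ θ x : ℝ} {p₀ : ℕ} (ha : 0 < a) (hA : 0 < A₀) (hβ : 0 ≤ β₀)
    (hp : 1 ≤ p₀) (hx1 : 1 ≤ x) (hx : 2 * θ * (1 + β₀) ^ 2 / (a * A₀ ^ 2) ≤ x) :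
    0 < A₀ * x ^ p₀ / (1 + β₀) ∧ θ / (A₀ * x ^ p₀ / (1 + β₀)) ^ 2 ≤ a / 2 := by
  have hb : 0 < 1 + β₀ := by linarith
  have hxp : x ≤ x ^ p₀ := le_self_pow₀ hx1 (by omega)
  have hP : 0 < A₀ * x ^ p₀ / (1 + β₀) := by positivity
  refine ⟨hP, ?_⟩
  rw [div_le_iff₀ (by positivity)]
  set P := A₀ * x ^ p₀ / (1 + β₀) with hPdef
  have h1 : 2 * θ * (1 + β₀) ^ 2 ≤ x * (a * A₀ ^ 2) := by rwa [div_le_iff₀ (by positivity)] at hx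
  have h2 : P ^ 2 * (1 + β₀) ^ 2 = A₀ ^ 2 * (x ^ p₀) ^ 2 := by
    rw [hPdef]; field_simp
  have h3 : x * (a * A₀ ^ 2) ≤ (x ^ p₀) ^ 2 * (a * A₀ ^ 2) := by
    apply mul_le_mul_of_nonneg_right _ (by positivity)
    calc x ≤ x ^ p₀ := hxp
      _ ≤ (x ^ p₀) ^ 2 := le_self_pow₀ (hx1.trans hxp) (by norm_num)
  have h4 : 2 * θ * (1 + β₀) ^ 2 ≤ a * P ^ 2 * (1 + β₀) ^ 2 := by
    calc 2 * θ * (1 + β₀) ^ 2 ≤ (x ^ p₀) ^ 2 * (a * A₀ ^ 2) := h1.trans h3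
      _ = a * (P ^ 2 * (1 + β₀) ^ 2) := by rw [h2]; ring
      _ = a * P ^ 2 * (1 + β₀) ^ 2 := by ring
  have h5 : 2 * θ ≤ a * P ^ 2 := le_of_mul_le_mul_right h4 (by positivity)
  linarith

/-! ## §2 The class-linear chain with NO room condition -/

section EndToEnd

variable {γ κ ι : Type*} [DecidableEq γ] [DecidableEq κ] {l₀ : ℝ} {K₀ : ℕ} {π : ℕ → ι → κ} {T : ℕ → Finset ι}
  {A A' : ℕ → ℝ → ι → ℝ} {Bad' : ℕ → ℝ → Finset κ} {dead dead' : ℕ → ℝ → ι → ℝ} {F Rf F' Rf' : ℕ → κ → ℝ}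
  {nlow nup mlow mup : ℕ → ℝ → ℝ} {Cn : ℝ}

/-- **`hlabG` WITH NO ROOM CONDITION.**  `PartnerMultiplicityFloor.exists_irThreshold_relWeightBoundG_floor` VERBATIM
except that the binder `θ < C.a · C.A₀ ^ 2` is REPLACED by `0 < C.a`: the class-linear surcharge `θ·Σ_{births}(d′+1)`
is paid, for EVERY `θ ≥ 0`, by half of `a` once the infrared threshold `x₀` is enlarged to
`max 1 (2θ(1+β₀)²∕(a·A₀²))` (the floor `p₀(g_K)∕(1+β₀) ≤ p₀(g_s)` of the typed (2.7)). [folklore] -/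
theorem exists_irThreshold_relWeightBoundG_threshold (C : T4PrintedShapeBanking.Consts) (hC : C.Valid) {θ : ℝ}
    (hθ : 0 ≤ θ) (ha : 0 < C.a) (hA₀ : 0 < C.A₀) {L r : ℕ} (hL : 1 ≤ L) {β₀ : ℝ} (hβ : 0 ≤ β₀)
    (hrq : r * (C.q' + 1) < C.p₀)
    (Cell : ℕ → ℕ → Finset γ) {V Λ : ℝ} (hV : 0 ≤ V) (hΛ : 0 < Λ)
    (hcell : ∀ K a, ((Cell K a).card : ℝ) ≤ V * Λ ^ a) (E B : ℕ → ℕ → Finset PEv)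
    (hE : ∀ K j, ∀ e ∈ E K j, PEv.step e ∈ Ioc j K) (jstar : ℕ → ℕ) (hj : ∀ K, jstar K ≤ K) {c : ℝ} (hc : 0 < c)
    (hfrac : ∀ K : ℕ, c * K ≤ ((K - jstar K : ℕ) : ℝ))
    (hA : Regeneration l₀ π T A Bad' dead F Rf nlow nup Cn K₀)
    (hA' : Regeneration l₀ π T A' Bad' dead' F' Rf' mlow mup Cn K₀) (hCn : 0 ≤ Cn) :
    ∃ x₀ : ℝ, ∀ (R : ℕ → ℕ → ℕ) (g : ℕ → ℕ → ℝ) (β' : ℕ → ℝ),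
      (∀ K, K₀ ≤ K → B14.FlowIneq27 (g K) (β' K) β₀ C.p₀ K) →
      (∀ K, K₀ ≤ K → B14FlowStep.FlowIneq29 (R K) (g K) L (β' K) β₀ K) →
      (∀ K, K₀ ≤ K → ∀ s, s ≤ K → B14.IsRj L r (g K s) (R K s)) →
      (∀ K, K₀ ≤ K → ∀ s, s ≤ K → 1 ≤ Real.log ((g K s) ^ 2)⁻¹) →
      (∀ K, K₀ ≤ K → x₀ ≤ Real.log ((g K K) ^ 2)⁻¹) →
      ∀ {ρbar ηbar : ℝ}, (∀ K j, ∑ b ∈ B K j, rho C (g K) b ≤ ρbar) →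
      (∀ K j, ∀ t ∈ Ioc j K, ∑ e ∈ E K j with PEv.step e = t, eta C e ≤ ηbar) →
      Λ * Real.exp (ηbar - C.κ₁) < 1 →
      ∀ {Λ' : ℝ}, 0 ≤ Λ' → Λ' * Real.exp (-C.κ₁) ≤ 1 →
      ∀ (y : ℕ → ℕ → γ → PEv → Finset PEv → ℝ),
      (∀ K, ∀ j ≤ K, ∀ z ∈ Cell K (K - j), ∀ b ∈ B K j,
        ∀ Q ∈ records (dictW (R K) C.n₁) j K (E K j) b, 0 ≤ y K j z b Q) →
      (∀ K, K₀ ≤ K → ∀ j ≤ K, ∀ z ∈ Cell K (K - j), ∀ b ∈ B K j,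
        ∀ Q ∈ records (dictW (R K) C.n₁) j K (E K j) b,
        y K j z b Q ≤ 0 ∨ ∃ G : Gen PEv, Consistent C K (R K) G ∧ G.WF (dictW (R K) C.n₁) ∧ G.rootStep = j ∧
          K < G.reach (dictW (R K) C.n₁) ∧ G.root = b ∧ G.events.erase G.root = Q ∧
          y K j z b Q ≤ Real.exp (θ * ∑ b' ∈ births G, ((b'.fat : ℝ) + 1)) *
            (Λ' ^ partnerAges PEv.step G * (Real.exp (-credits (credit C (g K)) G) *
              Real.exp (lifeCost (dictW (R K) C.n₁) (cost C K (R K)) G)))) →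
      ∀ (str : ℕ → κ → Finset (Slot γ PEv)),
      (∀ K t, |t| ≤ l₀ → K₀ ≤ K → Set.InjOn (str K) (Bad' K t)) →
      (∀ K t, |t| ≤ l₀ → K₀ ≤ K → ∀ c ∈ Bad' K t,
        str K c ⊆ liveSlots Cell (dictW (R K) C.n₁) E B K ∧
          ∃ o ∈ oldSlots Cell (dictW (R K) C.n₁) E B jstar K, o ∈ str K c) →
      (∀ K t, |t| ≤ l₀ → K₀ ≤ K → ∀ c ∈ Bad' K t, F K c * Rf K c ≤ famWeight (slotPrice (y K)) (str K c)) →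
      (∀ K t, |t| ≤ l₀ → K₀ ≤ K → ∀ c ∈ Bad' K t, F' K c * Rf' K c ≤ famWeight (slotPrice (y K)) (str K c)) →
      ∃ K₁, K₀ ≤ K₁ ∧ RelWeightBound l₀ T A A' (fun K t => if K₁ ≤ K then badOfClass π T Bad' K t else ∅)
        (Set.indicator {K | K₁ ≤ K} (fun K => Cn * recordsBudget ρbar C.κ₁ V Λ ηbar jstar K)) := by
  -- run the landed `M`-chain at HALF the quadratic constant
  set C' := lowerA C (C.a / 2) with hC'def
  have hC' : C'.Valid := lowerA_valid hC _
  have ha' : 0 < C'.a := by rw [hC'def, lowerA_a]; linarith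
  have hA₀' : 0 < C'.A₀ := by rw [hC'def, lowerA_A₀]; exact hA₀
  have hrq' : r * (C'.q' + 1) < C'.p₀ := hrq
  obtain ⟨x₀', hx₀'⟩ := exists_irThreshold_relWeightBoundM C' hC' ha' hA₀' hL hβ hrq' Cell hV hΛ
    hcell E B hE jstar hj hc hfrac hA hA' hCn
  have hp1 : 1 ≤ C.p₀ := by
    have : r * (C.q' + 1) < C.p₀ := hrq
    omega
  -- the enlarged infrared threshold
  set X := max 1 (2 * θ * (1 + β₀) ^ 2 / (C.a * C.A₀ ^ 2)) with hXdef
  refine ⟨max x₀' X, ?_⟩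
  intro R g β' h27 h29 hR hx1 hir ρbar ηbar hρbar hηbar hr Λ' hΛ0 hΛ1 y hy0 hlabG str hinj hstr hF hF'
  have hir' : ∀ K, K₀ ≤ K → x₀' ≤ Real.log ((g K K) ^ 2)⁻¹ := fun K hK => (le_max_left _ _).trans (hir K hK)
  have hlabM : ∀ K, K₀ ≤ K → ∀ j ≤ K, ∀ z ∈ Cell K (K - j), ∀ b ∈ B K j,
      ∀ Q ∈ records (dictW (R K) C.n₁) j K (E K j) b,
      y K j z b Q ≤ 0 ∨ ∃ G : Gen PEv, Consistent C' K (R K) G ∧ G.WF (dictW (R K) C.n₁) ∧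
        G.rootStep = j ∧ K < G.reach (dictW (R K) C.n₁) ∧ G.root = b ∧ G.events.erase G.root = Q ∧
        y K j z b Q ≤ Λ' ^ partnerAges PEv.step G * (Real.exp (-credits (credit C' (g K)) G) *
          Real.exp (lifeCost (dictW (R K) C.n₁) (cost C K (R K)) G)) := by
    intro K hK j hj z hz b hb Q hQ
    rcases hlabG K hK j hj z hz b hb Q hQ with h0 | ⟨G, hcG, hW, hrs, hKr, hroot, hQ', hy⟩
    · exact Or.inl h0
    · refine Or.inr ⟨G, (consistent_lowerA_iff C (C.a / 2) K (R K) G).2 hcG, hW, hrs, hKr, hroot, hQ', hy.trans ?_⟩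
      -- the infrared floor at this cutoff and the half-room
      have hxK : X ≤ Real.log ((g K K) ^ 2)⁻¹ := (le_max_right _ _).trans (hir K hK)
      have hxK1 : 1 ≤ Real.log ((g K K) ^ 2)⁻¹ := (le_max_left _ _).trans hxK
      have hxK2 : 2 * θ * (1 + β₀) ^ 2 / (C.a * C.A₀ ^ 2) ≤ Real.log ((g K K) ^ 2)⁻¹ := (le_max_right _ _).trans hxK
      obtain ⟨hP, hroom⟩ := half_room_of_threshold ha hA₀ hβ hp1 hxK1 hxK2
      set P := C.A₀ * Real.log ((g K K) ^ 2)⁻¹ ^ C.p₀ / (1 + β₀) with hPdef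
      have hPe : ∀ e ∈ G.events, e.kind = 0 → P ≤ p0Profile C.A₀ C.p₀ (g K e.step) := fun e he _ => by
        have hfl := floor_of_ir (h27 K hK) hβ hA₀.le (by linarith) (step_le_of_consistent hcG e he)
        simpa [p0Profile, hPdef] using hfl
      have key := exp_mul_fatSum_mul_exp_neg_credits_le_floor (g := g K) hθ hP hcG hPe
      -- antitonicity: lowering by `θ∕P² ≤ a∕2` leaves at least the credits of `C'`
      have hanti : Real.exp (-credits (credit (lowerA C (θ / P ^ 2)) (g K)) G) ≤
          Real.exp (-credits (credit C' (g K)) G) := by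
        rw [Real.exp_le_exp, neg_le_neg_iff, hC'def]
        exact credits_lowerA_anti C (g K) hroom G
      have hX : 0 ≤ Real.exp (lifeCost (dictW (R K) C.n₁) (cost C K (R K)) G) := (Real.exp_pos _).le
      have hΛp : 0 ≤ Λ' ^ partnerAges PEv.step G := pow_nonneg hΛ0 _
      calc Real.exp (θ * ∑ b' ∈ births G, ((b'.fat : ℝ) + 1)) *
            (Λ' ^ partnerAges PEv.step G * (Real.exp (-credits (credit C (g K)) G) *
              Real.exp (lifeCost (dictW (R K) C.n₁) (cost C K (R K)) G)))
          = Λ' ^ partnerAges PEv.step G *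
              ((Real.exp (θ * ∑ b' ∈ births G, ((b'.fat : ℝ) + 1)) * Real.exp (-credits (credit C (g K)) G)) *
                Real.exp (lifeCost (dictW (R K) C.n₁) (cost C K (R K)) G)) := by ring
        _ ≤ Λ' ^ partnerAges PEv.step G * (Real.exp (-credits (credit C' (g K)) G) *
              Real.exp (lifeCost (dictW (R K) C.n₁) (cost C K (R K)) G)) :=
            mul_le_mul_of_nonneg_left (mul_le_mul_of_nonneg_right (key.trans hanti) hX) hΛp
  exact hx₀' R g β' h27 h29 hR hx1 hir' hρbar hηbar hr hΛ0 hΛ1 y hy0 hlabM str hinj hstr hF hF'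

/-! ## §3 The zone-crowding chain with NO room condition -/

/-- **`hlabZ` WITH NO ROOM CONDITION.**  `PartnerMultiplicityFloor.exists_irThreshold_relWeightBoundZ_floor` VERBATIM
except that the binder `zoneRate Kz p σ ε θ < C.a · C.A₀ ^ 2` is REPLACED by `0 < C.a`: the zone-crowding multiplicity
(`Kz^{#merges}·∏ Q(wcnt G)^p·Λ′^{partnerAges}`, however large its typed constant `zoneRate`) is absorbed by the infrared
threshold `x₀`. [folklore] -/
theorem exists_irThreshold_relWeightBoundZ_threshold (C : T4PrintedShapeBanking.Consts) (hC : C.Valid)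
    {Kz p σ ε θ : ℝ} (hKz : 1 ≤ Kz) (hp : 0 ≤ p) (h0 : 0 < σ) (h1 : σ < 1) (hε : 0 < ε) (hθ : 0 < θ)
    (ha : 0 < C.a) (hA₀ : 0 < C.A₀) {L r : ℕ} (hL : 1 ≤ L) {β₀ : ℝ} (hβ : 0 ≤ β₀) (hrq : r * (C.q' + 1) < C.p₀)
    (Cell : ℕ → ℕ → Finset γ) {V Λ : ℝ} (hV : 0 ≤ V) (hΛ : 0 < Λ)
    (hcell : ∀ K a, ((Cell K a).card : ℝ) ≤ V * Λ ^ a) (E B : ℕ → ℕ → Finset PEv)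
    (hE : ∀ K j, ∀ e ∈ E K j, PEv.step e ∈ Ioc j K) (jstar : ℕ → ℕ) (hj : ∀ K, jstar K ≤ K) {c : ℝ} (hc : 0 < c)
    (hfrac : ∀ K : ℕ, c * K ≤ ((K - jstar K : ℕ) : ℝ))
    (hA : Regeneration l₀ π T A Bad' dead F Rf nlow nup Cn K₀)
    (hA' : Regeneration l₀ π T A' Bad' dead' F' Rf' mlow mup Cn K₀) (hCn : 0 ≤ Cn) :
    ∃ x₀ : ℝ, ∀ (R : ℕ → ℕ → ℕ) (g : ℕ → ℕ → ℝ) (β' : ℕ → ℝ),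
      (∀ K, K₀ ≤ K → B14.FlowIneq27 (g K) (β' K) β₀ C.p₀ K) →
      (∀ K, K₀ ≤ K → B14FlowStep.FlowIneq29 (R K) (g K) L (β' K) β₀ K) →
      (∀ K, K₀ ≤ K → ∀ s, s ≤ K → B14.IsRj L r (g K s) (R K s)) →
      (∀ K, K₀ ≤ K → ∀ s, s ≤ K → 1 ≤ Real.log ((g K s) ^ 2)⁻¹) →
      (∀ K, K₀ ≤ K → x₀ ≤ Real.log ((g K K) ^ 2)⁻¹) →
      ∀ {ρbar ηbar : ℝ}, (∀ K j, ∑ b ∈ B K j, rho C (g K) b ≤ ρbar) →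
      (∀ K j, ∀ t ∈ Ioc j K, ∑ e ∈ E K j with PEv.step e = t, eta C e ≤ ηbar) →
      Λ * Real.exp (ηbar - C.κ₁) < 1 →
      ∀ {Λ' : ℝ}, 0 ≤ Λ' → Λ' * Real.exp ε * Real.exp (-C.κ₁) ≤ 1 →
      ∀ (y : ℕ → ℕ → γ → PEv → Finset PEv → ℝ),
      (∀ K, ∀ j ≤ K, ∀ z ∈ Cell K (K - j), ∀ b ∈ B K j,
        ∀ Q ∈ records (dictW (R K) C.n₁) j K (E K j) b, 0 ≤ y K j z b Q) →
      (∀ K, K₀ ≤ K → ∀ j ≤ K, ∀ z ∈ Cell K (K - j), ∀ b ∈ B K j,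
        ∀ Q ∈ records (dictW (R K) C.n₁) j K (E K j) b,
        y K j z b Q ≤ 0 ∨ ∃ G : Gen PEv, Consistent C K (R K) G ∧ G.WF (dictW (R K) C.n₁) ∧ G.rootStep = j ∧
          K < G.reach (dictW (R K) C.n₁) ∧ G.root = b ∧ G.events.erase G.root = Q ∧
          y K j z b Q ≤ Kz ^ (merges G).card * (∏ e ∈ merges G, Crowding.Q (wcnt G) σ e.step ^ p) *
            Λ' ^ partnerAges PEv.step G * (Real.exp (-credits (credit C (g K)) G) *
              Real.exp (lifeCost (dictW (R K) C.n₁) (cost C K (R K)) G))) →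
      ∀ (str : ℕ → κ → Finset (Slot γ PEv)),
      (∀ K t, |t| ≤ l₀ → K₀ ≤ K → Set.InjOn (str K) (Bad' K t)) →
      (∀ K t, |t| ≤ l₀ → K₀ ≤ K → ∀ c ∈ Bad' K t,
        str K c ⊆ liveSlots Cell (dictW (R K) C.n₁) E B K ∧
          ∃ o ∈ oldSlots Cell (dictW (R K) C.n₁) E B jstar K, o ∈ str K c) →
      (∀ K t, |t| ≤ l₀ → K₀ ≤ K → ∀ c ∈ Bad' K t, F K c * Rf K c ≤ famWeight (slotPrice (y K)) (str K c)) →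
      (∀ K t, |t| ≤ l₀ → K₀ ≤ K → ∀ c ∈ Bad' K t, F' K c * Rf' K c ≤ famWeight (slotPrice (y K)) (str K c)) →
      ∃ K₁, K₀ ≤ K₁ ∧ RelWeightBound l₀ T A A' (fun K t => if K₁ ≤ K then badOfClass π T Bad' K t else ∅)
        (Set.indicator {K | K₁ ≤ K} (fun K => Cn * recordsBudget ρbar C.κ₁ V Λ ηbar jstar K)) := by
  have hθz : 0 ≤ zoneRate Kz p σ ε θ := zoneRate_nonneg hKz hp h0 h1 hθ.le
  obtain ⟨x₀, hx₀⟩ := exists_irThreshold_relWeightBoundG_threshold C hC hθz ha hA₀ hL hβ hrq Cell hV hΛ hcell E B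
    hE jstar hj hc hfrac hA hA' hCn
  refine ⟨x₀, ?_⟩
  intro R g β' h27 h29 hR hx1 hir ρbar ηbar hρbar hηbar hr Λ' hΛ0 hΛ1 y hy0 hlabZ str hinj hstr hF hF'
  have hΛ0' : 0 ≤ Λ' * Real.exp ε := mul_nonneg hΛ0 (Real.exp_pos ε).le
  have hlabG : ∀ K, K₀ ≤ K → ∀ j ≤ K, ∀ z ∈ Cell K (K - j), ∀ b ∈ B K j,
      ∀ Q ∈ records (dictW (R K) C.n₁) j K (E K j) b,
      y K j z b Q ≤ 0 ∨ ∃ G : Gen PEv, Consistent C K (R K) G ∧ G.WF (dictW (R K) C.n₁) ∧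
        G.rootStep = j ∧ K < G.reach (dictW (R K) C.n₁) ∧ G.root = b ∧ G.events.erase G.root = Q ∧
        y K j z b Q ≤ Real.exp (zoneRate Kz p σ ε θ * ∑ b' ∈ births G, ((b'.fat : ℝ) + 1)) *
          ((Λ' * Real.exp ε) ^ partnerAges PEv.step G * (Real.exp (-credits (credit C (g K)) G) *
            Real.exp (lifeCost (dictW (R K) C.n₁) (cost C K (R K)) G))) := by
    intro K hK j hj z hz b hb Q hQ
    rcases hlabZ K hK j hj z hz b hb Q hQ with h0' | ⟨G, hcG, hW, hrs, hKr, hroot, hQ', hy⟩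
    · exact Or.inl h0'
    · refine Or.inr ⟨G, hcG, hW, hrs, hKr, hroot, hQ', hy.trans ?_⟩
      have key := zone_surcharge_le (dictW (R K) C.n₁) hKz hp h0 h1 hε hθ hΛ0 hcG hW
      have hX : 0 ≤ Real.exp (-credits (credit C (g K)) G) *
          Real.exp (lifeCost (dictW (R K) C.n₁) (cost C K (R K)) G) := by positivity
      calc Kz ^ (merges G).card * (∏ e ∈ merges G, Crowding.Q (wcnt G) σ e.step ^ p) *
            Λ' ^ partnerAges PEv.step G * (Real.exp (-credits (credit C (g K)) G) *
              Real.exp (lifeCost (dictW (R K) C.n₁) (cost C K (R K)) G))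
          ≤ Real.exp (zoneRate Kz p σ ε θ * ∑ b' ∈ births G, ((b'.fat : ℝ) + 1)) *
              (Λ' * Real.exp ε) ^ partnerAges PEv.step G * (Real.exp (-credits (credit C (g K)) G) *
              Real.exp (lifeCost (dictW (R K) C.n₁) (cost C K (R K)) G)) := mul_le_mul_of_nonneg_right key hX
        _ = _ := by ring
  exact hx₀ R g β' h27 h29 hR hx1 hir hρbar hηbar hr hΛ0' (by simpa [mul_assoc] using hΛ1) y hy0 hlabG str
    hinj hstr hF hF'

end EndToEnd

/-! ## §4 Sanity -/

namespace Sanity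

/-- the half-room on numbers: `a = 1`, `A₀ = 1`, `β₀ = 0`, `θ = 3`, `p₀ = 2`, threshold `x = 6 = 2θ(1+β₀)²∕(aA₀²)`:
`P = 36`, `θ∕P² = 3∕1296 ≤ 1∕2` -/
theorem half_room_example :
    0 < (1 : ℝ) * (6 : ℝ) ^ 2 / (1 + 0) ∧ (3 : ℝ) / ((1 : ℝ) * (6 : ℝ) ^ 2 / (1 + 0)) ^ 2 ≤ 1 / 2 :=
  half_room_of_threshold (a := 1) (A₀ := 1) (β₀ := 0) (θ := 3) (p₀ := 2) (by norm_num) (by norm_num) le_rfl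
    (by norm_num) (by norm_num) (by norm_num)

/-- antitonicity on an instance: lowering by `2` gives at most the credit of lowering by `1` -/
theorem anti_example (C : T4PrintedShapeBanking.Consts) (g : ℕ → ℝ) (e : PEv) :
    credit (lowerA C 2) g e ≤ credit (lowerA C 1) g e :=
  credit_lowerA_anti C g (by norm_num) e

end Sanity

end

end Summit.QuantumFields.BalabanUV.T4Continuum.PartnerMultiplicityThreshold
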